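import Summits.CriticalPhenomena.PercolationContinuityZ3.Theorems.FK.NonzeroFieldGibbsUniqueness
import Summits.CriticalPhenomena.PercolationContinuityZ3.Theorems.FK.PositiveFieldPlusFreeAgreement
import Literature.Probability.LatticeModels.MeanFieldLowerBound
import HarnessLib

/-!
# SYMMETRY BREAKING BY AN INFINITESIMAL FIELD: AS `h ↓ 0` THE UNIQUE GIBBS STATE `μ_{β,h}` TENDS TO `μ⁺_{β,0}`, AS `h ↑ 0`
# TO `μ⁻_{β,0}` — `⟨σ_A⟩⁺_{β,0} = lim_{h↓0} ⟨σ_A⟩_{β,h}`, `⟨σ_A⟩⁻_{β,0} = lim_{h↑0} ⟨σ_A⟩_{β,h}`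
# (Friedli–Velenik 2017, Lemma 3.31, Prop. 3.29, Thm. 3.25 (1), §3.7.2)

Claimed R42 (8)(c) in the cell INBOX at 2026-08-29T01:45:00Z by fkp-10a gen 357 (NEW CLAIM #3 of the gen), addressed to coordinator fk-4 gen 288 (seated 01:00Z 2026-08-29 by l.8634; R160 / R161 in force); lineage row FO-10a-g357z (self-suggested), package g357-limit, label ZF-B.
Helper file of the `fk-continuity` build cell (bschramm lane; `--supports stmt-CriticalPhenomena-4575`); builds on
p205010 (kernel theorem, internal audit signed; external expert review pending). No definitions, no named facts, no
sorries; standard axioms. UNCONDITIONAL (nearest-neighbour Ising model on `ℤ^d`, `d ≥ 1`, `β > 0`).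

For `h ≠ 0` there is exactly one Gibbs measure (`hasUniqueGibbsMeasure_of_field_ne_zero`, `NonzeroFieldGibbsUniqueness`),
whose correlations are `plusCorr d β h` (`spinCorr_eq_plusCorr_of_field_ne_zero`); the plus state is right-continuous in
the field at `0` (`plusCorr_continuousWithinAt_Ici_field`) and the minus state is the spin flip of the plus state at `−h`
(`minusCorr_eq_plusCorr_neg`). Hence the two pure phases at `h = 0` are the one-sided limits of the unique states:

* `minusCorr_eq_plusCorr_of_field_ne_zero`, `freeCorr_eq_plusCorr_of_field_pos` — at `h ≠ 0` the minus (and, for `h > 0`,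
  the free) state coincide with the plus state on all spin products;
* **`tendsto_freeCorr_nhdsGT_zero`** — `⟨σ_A⟩^∅_{β,h} → ⟨σ_A⟩⁺_{β,0}` as `h ↓ 0` (every finite `A`, `β ≥ 0`): the FREE states
  in a vanishing positive field select the PLUS phase; `not_continuousWithinAt_freeCorr_singleton_field_zero` — for `d ≥ 2`
  and `β > β_c(d)`, `h ↦ ⟨σ_0⟩^∅_{β,h}` JUMPS at `h = 0` (from `m*(β) > 0` down to `⟨σ_0⟩^∅_{β,0} = 0`);
* **`tendsto_plusCorr_nhdsLT_zero`** — `⟨σ_A⟩⁺_{β,h} → ⟨σ_A⟩⁻_{β,0}` as `h ↑ 0` (`β > 0`): the (unique) states in a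
  vanishing NEGATIVE field select the MINUS phase;
* **`tendsto_spinCorr_nhdsGT_zero`**, **`tendsto_spinCorr_nhdsLT_zero`** — for ANY choice of Gibbs measures
  `μ_h ∈ 𝒢(β,h)`: `⟨σ_A⟩_{μ_h} → ⟨σ_A⟩⁺_{β,0}` as `h ↓ 0` and `→ ⟨σ_A⟩⁻_{β,0}` as `h ↑ 0` (`β > 0`, `d ≥ 1`) —
  Friedli–Velenik's characterisation of `μ^±` as the zero-field limits of the positive / negative-field states;
* `tendsto_spinCorr_singleton_nhdsGT_zero` / `_nhdsLT_zero` — in particular the magnetisation of the unique state tends to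
  `± m*(β)`: the jump across `h = 0` is `2 m*(β)`, nonzero iff `β > β_c(d)` (`d ≥ 2`).

## References

* S. Friedli, Y. Velenik, *Statistical Mechanics of Lattice Systems*, CUP (2017), Lemma 3.31, Prop. 3.29, Thm. 3.25 (1),
  §3.7.2, Exercise 3.15. [FriedliVelenik2017]
* H.-O. Georgii, *Gibbs Measures and Phase Transitions*, 2nd ed., de Gruyter (2011), §6.2. [Georgii2011]
-/

noncomputable section

namespace Summit.CriticalPhenomena.PercolationContinuityZ3.Theorems.FK

namespace IsingSusceptibility

open MeasureTheory Filter Topology Finset Set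
open Literature.Probability.LatticeModels

variable {d : ℕ}

/-! ### At `h ≠ 0` all three states coincide -/

/-- **`⟨σ_A⟩⁻_{β,h} = ⟨σ_A⟩⁺_{β,h}` for `h ≠ 0`** (`d ≥ 1`, `β > 0`): the minus state is a Gibbs measure
(`exists_minusMeasure_holds`) and the Gibbs measure is unique at `h ≠ 0`. [cite: FriedliVelenik2017, Thm. 3.25 (1)] -/
theorem minusCorr_eq_plusCorr_of_field_ne_zero (hd : 1 ≤ d) {β h : ℝ} (hβ : 0 < β) (hh : h ≠ 0)
    (A : Finset (Site d)) : minusCorr d β h A = plusCorr d β h A := by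
  obtain ⟨μm, hμm, -, hm⟩ := exists_minusMeasure_holds (d := d) (β := β) (h := h) hβ.le
  rw [← hm A]
  exact spinCorr_eq_plusCorr_of_field_ne_zero hd hβ hh hμm A

/-! ### `h ↓ 0`: the free / unique states select the plus phase -/

/-- `⟨σ_A⟩⁺_{β,h} → ⟨σ_A⟩⁺_{β,0}` as `h ↓ 0` (`β ≥ 0`; right-continuity of the plus state in the field, Friedli–Velenik
Lemma 3.31 (1)). [cite: FriedliVelenik2017, Lemma 3.31 (1)] -/
theorem tendsto_plusCorr_nhdsGT_zero {β : ℝ} (hβ : 0 ≤ β) (A : Finset (Site d)) :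
    Tendsto (fun h => plusCorr d β h A) (𝓝[>] 0) (𝓝 (plusCorr d β 0 A)) :=
  (plusCorr_continuousWithinAt_Ici_field hβ A le_rfl).tendsto.mono_left (nhdsWithin_mono _ Ioi_subset_Ici_self)

/-- **THE FREE STATES IN A VANISHING POSITIVE FIELD SELECT THE PLUS PHASE**: for `d ≥ 1`, `β ≥ 0` and every finite `A`,
`⟨σ_A⟩^∅_{β,h} → ⟨σ_A⟩⁺_{β,0}` as `h ↓ 0` (free = plus at `h > 0`, `freeCorr_eq_plusCorr_of_pos_field`, and right-continuity
of the plus state). [cite: FriedliVelenik2017, Thm. 3.25 (1) and Lemma 3.31; §3.7.2] -/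
theorem tendsto_freeCorr_nhdsGT_zero (hd : 1 ≤ d) {β : ℝ} (hβ : 0 ≤ β) (A : Finset (Site d)) :
    Tendsto (fun h => freeCorr d β h A) (𝓝[>] 0) (𝓝 (plusCorr d β 0 A)) := by
  refine (tendsto_plusCorr_nhdsGT_zero hβ A).congr' ?_
  filter_upwards [self_mem_nhdsWithin] with h hh
  exact (freeCorr_eq_plusCorr_of_pos_field hd hβ hh A).symm

/-- **`h ↦ ⟨σ_0⟩^∅_{β,h}` JUMPS AT `h = 0` ABOVE `β_c`**: for `d ≥ 2` and `β > β_c(d)`, the free one-point function is not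
continuous from the right at `h = 0` — its right limit is `m*(β) > 0` (`tendsto_freeCorr_nhdsGT_zero`) while
`⟨σ_0⟩^∅_{β,0} = 0` by symmetry (`freeCorr_singleton_eq_zero`). [cite: FriedliVelenik2017, §3.7.2 and Thm. 3.25 (3)] -/
theorem not_continuousWithinAt_freeCorr_singleton_field_zero (hd : 2 ≤ d) {β : ℝ} (hβc : criticalBeta d < β) :
    ¬ ContinuousWithinAt (fun h => freeCorr d β h {0}) (Ioi 0) 0 := by
  have hβ : 0 ≤ β := (criticalBeta_nonneg d).trans hβc.le
  intro hc
  have h1 : Tendsto (fun h => freeCorr d β h {0}) (𝓝[>] 0) (𝓝 (freeCorr d β 0 {0})) := hc.tendsto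
  have h2 := tendsto_freeCorr_nhdsGT_zero (d := d) (by omega) hβ {0}
  have heq : freeCorr d β 0 {0} = plusCorr d β 0 {0} := tendsto_nhds_unique h1 h2
  rw [freeCorr_singleton_eq_zero hβ 0, ← spontaneousMagnetization_eq_plusCorr] at heq
  exact (spontaneousMagnetization_pos_of_criticalBeta_lt_holds hd hβc).ne heq

/-- **`μ⁺_{β,0}` IS THE ZERO-FIELD LIMIT OF THE POSITIVE-FIELD STATES**: for `d ≥ 1`, `β > 0`, ANY choice of Gibbs measures
`μ_h ∈ 𝒢(β,h)` (`h > 0`) and every finite `A`, `⟨σ_A⟩_{μ_h} → ⟨σ_A⟩⁺_{β,0}` as `h ↓ 0` (each `μ_h` is the unique state,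
with correlations `plusCorr d β h`). [cite: FriedliVelenik2017, Thm. 3.25 (1), Lemma 3.31 and §3.7.2; Georgii2011, §6.2] -/
theorem tendsto_spinCorr_nhdsGT_zero (hd : 1 ≤ d) {β : ℝ} (hβ : 0 < β) {μ : ℝ → Measure (SpinConfig (Site d))}
    (hμ : ∀ h, 0 < h → μ h ∈ isingGibbsMeasures d β h) (A : Finset (Site d)) :
    Tendsto (fun h => spinCorr (μ h) A) (𝓝[>] 0) (𝓝 (plusCorr d β 0 A)) := by
  refine (tendsto_plusCorr_nhdsGT_zero hβ.le A).congr' ?_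
  filter_upwards [self_mem_nhdsWithin] with h hh
  exact (spinCorr_eq_plusCorr_of_field_ne_zero hd hβ (ne_of_gt hh) (hμ h hh) A).symm

/-! ### `h ↑ 0`: the unique states select the minus phase -/

/-- **THE STATES IN A VANISHING NEGATIVE FIELD SELECT THE MINUS PHASE**: for `d ≥ 1`, `β > 0` and every finite `A`,
`⟨σ_A⟩⁺_{β,h} → ⟨σ_A⟩⁻_{β,0}` as `h ↑ 0` (at `h < 0` the plus state is the unique state; it is the spin flip of the plus state
at `−h > 0`, which tends to the flip of `μ⁺_{β,0}`, i.e. `μ⁻_{β,0}`). [cite: FriedliVelenik2017, §3.7.2, Thm. 3.25 (1) and Lemma 3.31] -/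
theorem tendsto_plusCorr_nhdsLT_zero (hd : 1 ≤ d) {β : ℝ} (hβ : 0 < β) (A : Finset (Site d)) :
    Tendsto (fun h => plusCorr d β h A) (𝓝[<] 0) (𝓝 (minusCorr d β 0 A)) := by
  -- `plusCorr d β h A = minusCorr d β h A = (-1)^|A| plusCorr d β (-h) A` for `h < 0`
  have hneg : Tendsto (fun h : ℝ => -h) (𝓝[<] (0 : ℝ)) (𝓝[>] 0) := by
    have := tendsto_neg_nhdsLT (a := (0 : ℝ))
    rwa [neg_zero] at this
  have h1 : Tendsto (fun h : ℝ => (-1 : ℝ) ^ #A * plusCorr d β (-h) A) (𝓝[<] 0)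
      (𝓝 ((-1 : ℝ) ^ #A * plusCorr d β 0 A)) :=
    ((tendsto_plusCorr_nhdsGT_zero hβ.le A).comp hneg).const_mul _
  rw [minusCorr_eq_plusCorr_neg hβ.le 0 A, neg_zero]
  refine h1.congr' ?_
  filter_upwards [self_mem_nhdsWithin] with h hh
  rw [← minusCorr_eq_plusCorr_neg hβ.le h A, minusCorr_eq_plusCorr_of_field_ne_zero hd hβ (ne_of_lt hh) A]

/-- **`μ⁻_{β,0}` IS THE ZERO-FIELD LIMIT OF THE NEGATIVE-FIELD STATES**: for `d ≥ 1`, `β > 0`, ANY Gibbs measures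
`μ_h ∈ 𝒢(β,h)` (`h < 0`) and every finite `A`, `⟨σ_A⟩_{μ_h} → ⟨σ_A⟩⁻_{β,0}` as `h ↑ 0`.
[cite: FriedliVelenik2017, §3.7.2 and Thm. 3.25 (1); Georgii2011, §6.2] -/
theorem tendsto_spinCorr_nhdsLT_zero (hd : 1 ≤ d) {β : ℝ} (hβ : 0 < β) {μ : ℝ → Measure (SpinConfig (Site d))}
    (hμ : ∀ h, h < 0 → μ h ∈ isingGibbsMeasures d β h) (A : Finset (Site d)) :
    Tendsto (fun h => spinCorr (μ h) A) (𝓝[<] 0) (𝓝 (minusCorr d β 0 A)) := by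
  refine (tendsto_plusCorr_nhdsLT_zero hd hβ A).congr' ?_
  filter_upwards [self_mem_nhdsWithin] with h hh
  exact (spinCorr_eq_plusCorr_of_field_ne_zero hd hβ (ne_of_lt hh) (hμ h hh) A).symm

/-! ### The magnetisation of the unique state jumps by `2 m*(β)` across `h = 0` -/

/-- As `h ↓ 0` the magnetisation of any Gibbs state tends to `+m*(β)` (`d ≥ 1`, `β > 0`).
[cite: FriedliVelenik2017, Prop. 3.29 and §3.7.2] -/
theorem tendsto_spinCorr_singleton_nhdsGT_zero (hd : 1 ≤ d) {β : ℝ} (hβ : 0 < β)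
    {μ : ℝ → Measure (SpinConfig (Site d))} (hμ : ∀ h, 0 < h → μ h ∈ isingGibbsMeasures d β h) :
    Tendsto (fun h => spinCorr (μ h) {0}) (𝓝[>] 0) (𝓝 (spontaneousMagnetization d β)) := by
  rw [spontaneousMagnetization_eq_plusCorr]
  exact tendsto_spinCorr_nhdsGT_zero hd hβ hμ {0}

/-- As `h ↑ 0` the magnetisation of any Gibbs state tends to `−m*(β)` (`d ≥ 1`, `β > 0`): across `h = 0` the magnetisation
of the (unique for `h ≠ 0`) Gibbs state jumps by `2 m*(β)`, which is nonzero iff `β > β_c(d)` (`d ≥ 2`).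
[cite: FriedliVelenik2017, Prop. 3.29, §3.7.2 and Thm. 3.25] -/
theorem tendsto_spinCorr_singleton_nhdsLT_zero (hd : 1 ≤ d) {β : ℝ} (hβ : 0 < β)
    {μ : ℝ → Measure (SpinConfig (Site d))} (hμ : ∀ h, h < 0 → μ h ∈ isingGibbsMeasures d β h) :
    Tendsto (fun h => spinCorr (μ h) {0}) (𝓝[<] 0) (𝓝 (-spontaneousMagnetization d β)) := by
  have h1 := tendsto_spinCorr_nhdsLT_zero hd hβ hμ {0}
  rwa [minusCorr_eq_plusCorr_neg hβ.le 0 {0}, neg_zero, Finset.card_singleton, pow_one, neg_one_mul,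
    ← spontaneousMagnetization_eq_plusCorr] at h1

end IsingSusceptibility

end Summit.CriticalPhenomena.PercolationContinuityZ3.Theorems.FK

end
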